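import Summits.BirchSwinnertonDyer.BirchSwinnertonDyer.Theorems.PrintCf2SplitBadTwoHPrimeCyclotomic
import Literature.NumberTheory.EllipticCurves.ZpExtensionIdelicCharacterProofs
import Literature.NumberTheory.GaloisRepresentations.CyclotomicCharacterArtinNormProofs
import Literature.NumberTheory.GaloisRepresentations.PadicAlgebraDegreeOnePlace
import Literature.NumberTheory.GaloisRepresentations.LocalKroneckerWeberInertiaProofs
import HarnessLib

/-!
# F2′: an inertia element at `v ∣ 2` which lies in `Gal(K̄/K̃_∞)` and sends `√−1 ↦ −√−1`

Cell `bsd-print-cf2`, width seat `bsd-line-cf2-p1-w8` g6; class item `MainConjClauseAtSplitTwoQuadDAClass` (rev 23,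
`stmt-BirchSwinnertonDyer-23300`).  NAMED PIECE of -plan g21 R-MU4 16:43:16Z («F2′ =
`exists_mem_inertia_mem_pairKer_smul_sqrt_neg_one_eq_neg` at `v` and its `v̄` twin»; -ref g18 16:42:01Z recipe: the local
Artin symbol of the UNIT `−1 ∈ K_v = ℚ₂`).  With it a BAD frame `γ₁` (moving `√−1`) becomes the GOOD frame `γ₁τ` with the
same pair-images (LEAD's `stub_goodTwistOfFrame`).  `--supports` 23300 (helper); Theses-free; THEOREMS ONLY; 0 facts.

Proof (all tree theorems): THE local Artin map `a_v : W_{K_v} → K_vˣ` maps the Weil inertia ONTO `𝒪_vˣ`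
(`IsLocalArtinMap.image_inertia`, `isLocalArtinMap_canonicalArtin_holds`), so some `w ∈ I(W_{K_v})` has `a_v(w) = −1`;
`τ := res_v w ∈ GreenbergSelmer.inertia v`.  (a) `κ(τ) = 1` for EVERY `ℤ₂`-extension `κ`: the idelic avatar `Λ` of `κ`
(`ZpExtension.exists_idelicCharacter`) has `Λ(⟨a_v w⟩_v) = κ(res_v w)⁻¹` (`idelicCharacter_localUnits_canonicalArtin`) and
`⟨−1⟩² = 1`, while `ℤ₂` has no `2`-torsion.  (b) `χ_cyc(τ) = χ_cyc(w) = N_{K_v/ℚ₂}(a_v w) = N(−1) = −1`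
(`cyclotomicCharacter_absGaloisRestrict`, `cyclotomicCharacter_toAbsGalois_eq_norm_canonicalArtin`, `[K_v : ℚ₂] = 1` at a split
place: `bijective_algebraMap_adicCompletionPadicAlgebra_of_split`), hence `τ(i) = i^{χ(τ)} = −i`
(`FineSelmerUpstairs.smul_eq_self_iff_toZModPow_two_cyclotomicCharacter_eq_one`).

* ★★ `exists_mem_inertia_mem_pairKer_smul_sqrt_neg_one_eq_neg` — `K` imaginary quadratic, `2 = v·v̄` split, ANY two
  `ℤ₂`-extensions `κ₁, κ₂`, `i² = −1`: `∃ τ ∈ GreenbergSelmer.inertia v, τ ∈ pairKer κ₁ κ₂ ∧ τ • i = −i`; the `v̄` twin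
  is the same theorem with `(v, v̄)` swapped (`exists_mem_inertia_bar_mem_pairKer_smul_sqrt_neg_one_eq_neg`).

HONEST FRAMING: closes nothing by itself; no summit statement is proved by this seat; BSD is not proved by any of this.

## References
* [SerreLocalFields1979] J.-P. Serre, *Local Fields* (1979), Ch. XIII §4 Thm. 2, Cor. to Prop. 13; Ch. XIV §7.
* [NeukirchANT1999] J. Neukirch, *Algebraic Number Theory* (1999), Ch. VI §5 Prop. (5.6), §6 Thm. (6.1).
* [Washington1997] L. C. Washington, *Introduction to Cyclotomic Fields* (1997), §13.1.
-/

-- the summit namespace `Summit.BirchSwinnertonDyer.BirchSwinnertonDyer` repeats the problem name by design (D-0017)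
set_option linter.dupNamespace false
set_option autoImplicit false

noncomputable section

open scoped Classical

open Field NumberField IsDedekindDomain Literature.NumberTheory.EllipticCurves
  Literature.NumberTheory.GaloisRepresentations

namespace Summit.BirchSwinnertonDyer.BirchSwinnertonDyer.Theorems.PrintCf2.UpsilonSurjects

variable {K : Type} [Field K] [NumberField K]

/-- In `Multiplicative ℤ_[p]` the only element of square `1` is `1` (`ℤ_p` has no `2`-torsion). [folklore] -/
theorem eq_one_of_sq_eq_one_multiplicative_padicInt {p : ℕ} [Fact p.Prime] {x : Multiplicative ℤ_[p]}
    (hx : x ^ 2 = 1) : x = 1 := by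
  have h : Multiplicative.toAdd x + Multiplicative.toAdd x = 0 := by
    have := congrArg Multiplicative.toAdd hx
    rwa [toAdd_pow, toAdd_one, two_nsmul] at this
  exact Multiplicative.toAdd.injective (by rw [toAdd_one]; exact add_self_eq_zero.mp h)

/-- ★★ **F2′ at `v`**: `K` imaginary quadratic with `2 = v·v̄` split, `κ₁, κ₂` ANY two `ℤ₂`-extensions of `K`,
`i² = −1`; then **some `τ ∈ GreenbergSelmer.inertia v` lies in `pairKer κ₁ κ₂` and has `τ • i = −i`** — the
restriction to `Γ_K` of a Weil inertia element `w` of `K_v` with local Artin symbol `a_v(w) = −1`.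
[cite: SerreLocalFields1979, Ch. XIII §4 Thm. 2] [cite: NeukirchANT1999, Ch. VI §5 Prop. (5.6)] [cite: Washington1997, §13.1] -/
theorem exists_mem_inertia_mem_pairKer_smul_sqrt_neg_one_eq_neg (hK : IsImaginaryQuadratic K)
    {v vbar : HeightOneSpectrum (𝓞 K)} (hv : ((2 : ℕ) : 𝓞 K) ∈ v.asIdeal) (hvbar : ((2 : ℕ) : 𝓞 K) ∈ vbar.asIdeal)
    (hne : vbar ≠ v) (κ₁ κ₂ : ZpExtension K 2) {i : AlgebraicClosure K} (hi : i ^ 2 = -1) :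
    ∃ τ ∈ GreenbergSelmer.inertia v, τ ∈ ZpExtension.pairKer κ₁ κ₂ ∧ τ • i = -i := by
  haveI : CharZero (v.adicCompletion K) := LocalField.charZero_adicCompletion v
  have ha := isLocalArtinMap_canonicalArtin_holds (v.adicCompletion K)
  -- (1) a Weil inertia element with local Artin symbol `−1`
  have hmem : (-1 : (v.adicCompletion K)ˣ) ∈
      (ValuativeRel.valuation (v.adicCompletion K)).valuationSubring.unitGroup := by
    rw [Valuation.mem_unitGroup_iff, Units.val_neg, Units.val_one, Valuation.map_neg, map_one]
  rw [← ha.image_inertia] at hmem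
  obtain ⟨w, hw, hart⟩ := Subgroup.mem_map.mp hmem
  refine ⟨absGaloisRestrict K (v.adicCompletion K) (WeilGroup.toAbsGalois (v.adicCompletion K) w),
    Subgroup.mem_map.mpr ⟨WeilGroup.toAbsGalois _ w, WeilGroup.mem_inertia_iff.mp hw, rfl⟩, ?_, ?_⟩
  · -- (2) every `ℤ₂`-extension kills `res_v w`: `Λ(⟨−1⟩_v)² = 1` and `ℤ₂` has no `2`-torsion
    have hkill : ∀ κ : ZpExtension K 2,
        κ (absGaloisRestrict K (v.adicCompletion K) (WeilGroup.toAbsGalois (v.adicCompletion K) w)) = 1 := by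
      intro κ
      obtain ⟨Λ, hΛ⟩ := ZpExtension.exists_idelicCharacter κ.toContinuousMonoidHom
      have h1 := ZpExtension.idelicCharacter_localUnits_canonicalArtin κ hΛ v w
      rw [hart] at h1
      have h2 : (Λ (localUnits v (-1 : (v.adicCompletion K)ˣ))) ^ 2 = 1 := by
        rw [← map_pow, ← map_pow, neg_one_sq, map_one, map_one]
      rw [h1, inv_pow, inv_eq_one] at h2
      exact eq_one_of_sq_eq_one_multiplicative_padicInt h2
    exact ZpExtension.mem_pairKer_iff.mpr ⟨hkill κ₁, hkill κ₂⟩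
  · -- (3) `χ_cyc(res_v w) = N_{K_v/ℚ₂}(−1) = −1`, so `res_v w` negates `√−1`
    haveI : Algebra.IsQuadraticExtension ℚ K := ⟨hK.1⟩
    have hℓ := LocalField.valuation_adicCompletion_natCast_lt_one v 2 hv
    have hcyc := cyclotomicCharacter_toAbsGalois_eq_norm_canonicalArtin (ℓ := 2) (v.adicCompletion K) hℓ hw
    letI := LocalField.padicAlgebra (v.adicCompletion K) 2 hℓ
    have hbij := LocalField.bijective_algebraMap_adicCompletionPadicAlgebra_of_split (p := 2) v vbar hne.symm hv hvbar
    have hfin : Module.finrank ℚ_[2] (v.adicCompletion K) = 1 := by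
      rw [← (LinearEquiv.ofBijective (Algebra.linearMap ℚ_[2] (v.adicCompletion K)) hbij).finrank_eq,
        Module.finrank_self]
    have hnorm : Algebra.norm ℚ_[2] (((canonicalArtin (v.adicCompletion K) w : (v.adicCompletion K)ˣ) :
        v.adicCompletion K)) = -1 := by
      rw [hart, Units.val_neg, Units.val_one,
        show (-1 : v.adicCompletion K) = algebraMap ℚ_[2] (v.adicCompletion K) (-1) by rw [map_neg, map_one],
        Algebra.norm_algebraMap, hfin, pow_one]
    rw [hnorm] at hcyc
    have hχv : GaloisRep.cyclotomicCharacter (v.adicCompletion K) 2 (WeilGroup.toAbsGalois (v.adicCompletion K) w) = -1 := by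
      apply Units.ext
      have h' : (((GaloisRep.cyclotomicCharacter (v.adicCompletion K) 2
          (WeilGroup.toAbsGalois (v.adicCompletion K) w) : ℤ_[2]ˣ) : ℤ_[2]) : ℚ_[2]) =
          (((-1 : ℤ_[2]ˣ) : ℤ_[2]) : ℚ_[2]) := by
        rw [hcyc, Units.val_neg, Units.val_one, PadicInt.coe_neg, PadicInt.coe_one]
      exact PadicInt.ext h'
    have hχK : GaloisRep.cyclotomicCharacter K 2
        (absGaloisRestrict K (v.adicCompletion K) (WeilGroup.toAbsGalois (v.adicCompletion K) w)) = -1 := by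
      haveI : NeZero ((2 : ℕ) : K) := ⟨by exact_mod_cast (two_ne_zero : (2 : K) ≠ 0)⟩
      rw [cyclotomicCharacter_absGaloisRestrict K (v.adicCompletion K) 2, hχv]
    set τ := absGaloisRestrict K (v.adicCompletion K) (WeilGroup.toAbsGalois (v.adicCompletion K) w) with hτ
    have hpm : τ • i = i ∨ τ • i = -i := by
      apply sq_eq_sq_iff_eq_or_eq_neg.mp
      rw [← smul_pow', hi, smul_neg, smul_one]
    refine hpm.resolve_left fun hfix ↦ ?_
    have h4 := (FineSelmerUpstairs.smul_eq_self_iff_toZModPow_two_cyclotomicCharacter_eq_one i hi τ).mp hfix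
    rw [hχK, Units.val_neg, Units.val_one, map_neg, map_one] at h4
    exact absurd h4 (by decide)

/-- ★★ **F2′ at `v̄`** (the twin, by symmetry of the hypotheses): some `τ ∈ GreenbergSelmer.inertia v̄` lies in
`pairKer κ₁ κ₂` and has `τ • i = −i`. [cite: SerreLocalFields1979, Ch. XIII §4 Thm. 2] [cite: Washington1997, §13.1] -/
theorem exists_mem_inertia_bar_mem_pairKer_smul_sqrt_neg_one_eq_neg (hK : IsImaginaryQuadratic K)
    {v vbar : HeightOneSpectrum (𝓞 K)} (hv : ((2 : ℕ) : 𝓞 K) ∈ v.asIdeal) (hvbar : ((2 : ℕ) : 𝓞 K) ∈ vbar.asIdeal)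
    (hne : vbar ≠ v) (κ₁ κ₂ : ZpExtension K 2) {i : AlgebraicClosure K} (hi : i ^ 2 = -1) :
    ∃ τ ∈ GreenbergSelmer.inertia vbar, τ ∈ ZpExtension.pairKer κ₁ κ₂ ∧ τ • i = -i :=
  exists_mem_inertia_mem_pairKer_smul_sqrt_neg_one_eq_neg hK hvbar hv hne.symm κ₁ κ₂ hi

end Summit.BirchSwinnertonDyer.BirchSwinnertonDyer.Theorems.PrintCf2.UpsilonSurjects
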